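import Mathlib
/-! # Stub `stub_localisation` — crux `TwoProducts` (stmt-ValiantsHypothesis-5906), line `corner-log-linearization`
   Localisation to the dead letters.  Let `D = ∏ u − ∏ v`, `w` a strictly positive integer weight and `e`
   the unique `w`-minimiser of `supp D`.  Then either `e` is a letter (a monomial of some factor `u_i` or
   `v_i`), or `e` is still the unique `w`-minimiser of `supp D‡`, `D‡ = ∏ U − ∏ V`, where `U_i` (`V_i`) is
   `u_i` (`v_i`) with every monomial lying in `supp D` deleted.  Proof: with `r_i = u_i − U_i` (so
   `supp r_i ⊆ supp D ∩ supp u_i`), every exponent of `∏ u − ∏ U` is `a + rest` with `a` a deleted letter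
   (induction on the number of factors: `∏ u − ∏ U = u₀ (∏' u − ∏' U) + (u₀ − U₀) ∏' U`); such an exponent
   weighs `> wt e` unless it is `e = a` itself.  Hence for `e` not a letter `coeff_e D‡ = coeff_e D ≠ 0`, and
   every `e' ∈ supp D‡ ∖ supp D` weighs strictly more than `e`. [folklore] -/
set_option linter.dupNamespace false -- single-conjunct summit: `ValiantsHypothesis.ValiantsHypothesis`
namespace Summit.ValiantsHypothesis.ValiantsHypothesis.Theorems.TwoProducts.Localisation
open scoped BigOperators Pointwise
open MvPolynomial

/-! ### Truncation: deleting the monomials with exponent in a fixed finset `S` -/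

/-- Coefficients of the truncation `Σ_{a ∈ supp p, a ∉ S} coeff_a p · X^a`: those with exponent in `S`
are deleted, the others are kept. [folklore] -/
theorem coeff_trunc (S : Finset (Fin 2 →₀ ℕ)) (p : MvPolynomial (Fin 2) ℂ) (b : Fin 2 →₀ ℕ) :
    coeff b (∑ a ∈ p.support with a ∉ S, monomial a (coeff a p)) = if b ∈ S then 0 else coeff b p := by
  simp only [coeff_sum, coeff_monomial, Finset.sum_ite_eq', Finset.mem_filter]
  by_cases hS : b ∈ S
  · simp [hS]
  · by_cases hp : b ∈ p.support
    · simp [hS, hp]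
    · simp [hS, hp, notMem_support_iff.mp hp]

/-- The deleted part `p − p‡` of `p` is supported on `S ∩ supp p`. [folklore] -/
theorem mem_of_mem_support_sub_trunc (S : Finset (Fin 2 →₀ ℕ)) (p : MvPolynomial (Fin 2) ℂ)
    (b : Fin 2 →₀ ℕ) (hb : b ∈ (p - ∑ a ∈ p.support with a ∉ S, monomial a (coeff a p)).support) :
    b ∈ S ∧ b ∈ p.support := by
  rw [mem_support_iff, coeff_sub, coeff_trunc] at hb
  by_cases hS : b ∈ S
  · rw [if_pos hS, sub_zero] at hb
    exact ⟨hS, mem_support_iff.mpr hb⟩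
  · rw [if_neg hS, sub_self] at hb
    exact absurd rfl hb

/-! ### Word expansion of `∏ u − ∏ U` -/

/-- If every `u_i − U_i` is supported on `S ∩ supp u_i`, then every exponent of `∏ u − ∏ U` is `a + rest`
with `a ∈ S ∩ supp u_i` for some `i` (expand `∏ (U_i + r_i)`; done by induction on the number of factors via
`∏ u − ∏ U = u₀ · (∏' u − ∏' U) + (u₀ − U₀) · ∏' U`). [folklore] -/
theorem exists_letter_add (S : Finset (Fin 2 →₀ ℕ)) : ∀ (n : ℕ) (u U : Fin n → MvPolynomial (Fin 2) ℂ),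
    (∀ i, ∀ b ∈ (u i - U i).support, b ∈ S ∧ b ∈ (u i).support) →
    ∀ x ∈ (∏ i, u i - ∏ i, U i).support,
      ∃ i, ∃ a rest : Fin 2 →₀ ℕ, a ∈ S ∧ a ∈ (u i).support ∧ x = a + rest := by
  intro n
  induction n with
  | zero =>
    intro u U _ x hx
    rw [Fin.prod_univ_zero, Fin.prod_univ_zero, sub_self, support_zero] at hx
    exact absurd hx (Finset.notMem_empty x)
  | succ n ih =>
    intro u U hU x hx
    have key : ∏ i, u i - ∏ i, U i =
        u 0 * (∏ i : Fin n, u i.succ - ∏ i : Fin n, U i.succ) + (u 0 - U 0) * ∏ i : Fin n, U i.succ := by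
      rw [Fin.prod_univ_succ, Fin.prod_univ_succ]; ring
    rw [key] at hx
    rcases Finset.mem_union.mp (support_add hx) with h | h
    · obtain ⟨p, -, y, hy, rfl⟩ := Finset.mem_add.mp (support_mul _ _ h)
      obtain ⟨i, a, rest, haS, hau, rfl⟩ :=
        ih (fun i => u i.succ) (fun i => U i.succ) (fun i => hU i.succ) y hy
      exact ⟨i.succ, a, p + rest, haS, hau, by rw [add_left_comm]⟩
    · obtain ⟨a, ha, q, -, rfl⟩ := Finset.mem_add.mp (support_mul _ _ h)
      exact ⟨0, a, q, (hU 0 a ha).1, (hU 0 a ha).2, rfl⟩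

/-! ### Weights -/

/-- Additivity of the linear weight `x ↦ w₀ x₀ + w₁ x₁` on `ℕ²`. -/
theorem wt_add (w : Fin 2 → ℤ) (a b : Fin 2 →₀ ℕ) :
    w 0 * ((a + b) 0 : ℤ) + w 1 * ((a + b) 1 : ℤ) =
      w 0 * (a 0 : ℤ) + w 1 * (a 1 : ℤ) + (w 0 * (b 0 : ℤ) + w 1 * (b 1 : ℤ)) := by
  simp only [Finsupp.add_apply, Nat.cast_add]; ring

/-- For an additive weight `φ ≥ 0` on `ℕ²`, positive off `0`: if `e` is the strict `φ`-minimiser on `S`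
and `a ∈ S`, then `a + rest` weighs strictly more than `e` unless it equals `e`, and in that case `a = e`
(and `rest = 0`). [folklore] -/
theorem letter_add_lt (φ : (Fin 2 →₀ ℕ) → ℤ) (hadd : ∀ a b, φ (a + b) = φ a + φ b)
    (hnn : ∀ x, 0 ≤ φ x) (hpos : ∀ x, x ≠ 0 → 0 < φ x) (S : Finset (Fin 2 →₀ ℕ)) (e : Fin 2 →₀ ℕ)
    (hmin : ∀ e' ∈ S, e' ≠ e → φ e < φ e') (a rest : Fin 2 →₀ ℕ) (ha : a ∈ S) :
    (a + rest ≠ e → φ e < φ (a + rest)) ∧ (a + rest = e → a = e) := by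
  have hr := hnn rest
  rcases eq_or_ne a e with rfl | hne
  · refine ⟨fun h => ?_, fun _ => rfl⟩
    have h0 : rest ≠ 0 := fun h0 => h (by rw [h0, add_zero])
    have := hpos rest h0
    rw [hadd]
    linarith
  · have hlt := hmin a ha hne
    refine ⟨fun _ => by rw [hadd]; linarith, fun h => absurd hlt ?_⟩
    rw [← h, hadd]
    linarith

/-! ### Localisation -/

/-- General localisation: if every `u_i − U_i` and `v_i − V_i` is supported on `supp D ∩ supp u_i` (resp.
`supp D ∩ supp v_i`), `D = ∏ u − ∏ v`, then a strict `φ`-minimiser `e` of `supp D` (`φ` an additive weight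
on `ℕ²`, positive off `0`) is a letter of some factor or a strict `φ`-minimiser of `supp (∏ U − ∏ V)`.
[folklore] -/
theorem localisation_of_support_sub {n : ℕ} (u v U V : Fin n → MvPolynomial (Fin 2) ℂ)
    (φ : (Fin 2 →₀ ℕ) → ℤ) (hadd : ∀ a b, φ (a + b) = φ a + φ b) (hnn : ∀ x, 0 ≤ φ x)
    (hpos : ∀ x, x ≠ 0 → 0 < φ x) (e : Fin 2 →₀ ℕ)
    (hU : ∀ i, ∀ b ∈ (u i - U i).support, b ∈ (∏ i, u i - ∏ i, v i).support ∧ b ∈ (u i).support)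
    (hV : ∀ i, ∀ b ∈ (v i - V i).support, b ∈ (∏ i, u i - ∏ i, v i).support ∧ b ∈ (v i).support)
    (he : e ∈ (∏ i, u i - ∏ i, v i).support)
    (hmin : ∀ e' ∈ (∏ i, u i - ∏ i, v i).support, e' ≠ e → φ e < φ e') :
    (∃ i, e ∈ (u i).support ∨ e ∈ (v i).support) ∨
    (e ∈ (∏ i, U i - ∏ i, V i).support ∧
      ∀ e' ∈ (∏ i, U i - ∏ i, V i).support, e' ≠ e → φ e < φ e') := by
  have keyU : ∀ x ∈ (∏ i, u i - ∏ i, U i).support,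
      (x ≠ e → φ e < φ x) ∧ (x = e → ∃ i, e ∈ (u i).support) := by
    intro x hx
    obtain ⟨i, a, rest, haS, hau, rfl⟩ := exists_letter_add _ n u U hU x hx
    obtain ⟨h1, h2⟩ := letter_add_lt φ hadd hnn hpos _ e hmin a rest haS
    exact ⟨h1, fun h => ⟨i, h2 h ▸ hau⟩⟩
  have keyV : ∀ x ∈ (∏ i, v i - ∏ i, V i).support,
      (x ≠ e → φ e < φ x) ∧ (x = e → ∃ i, e ∈ (v i).support) := by
    intro x hx
    obtain ⟨i, a, rest, haS, hav, rfl⟩ := exists_letter_add _ n v V hV x hx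
    obtain ⟨h1, h2⟩ := letter_add_lt φ hadd hnn hpos _ e hmin a rest haS
    exact ⟨h1, fun h => ⟨i, h2 h ▸ hav⟩⟩
  by_cases hlet : ∃ i, e ∈ (u i).support ∨ e ∈ (v i).support
  · exact Or.inl hlet
  right
  push Not at hlet
  have heU : e ∉ (∏ i, u i - ∏ i, U i).support := fun h => by
    obtain ⟨i, hi⟩ := (keyU e h).2 rfl
    exact (hlet i).1 hi
  have heV : e ∉ (∏ i, v i - ∏ i, V i).support := fun h => by
    obtain ⟨i, hi⟩ := (keyV e h).2 rfl
    exact (hlet i).2 hi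
  have hcoeff : ∀ x, coeff x (∏ i, U i - ∏ i, V i) = coeff x (∏ i, u i - ∏ i, v i) -
      (coeff x (∏ i, u i - ∏ i, U i) - coeff x (∏ i, v i - ∏ i, V i)) := by
    intro x
    simp only [coeff_sub]
    ring
  refine ⟨?_, fun e' he' hne => ?_⟩
  · rw [mem_support_iff, hcoeff, notMem_support_iff.mp heU, notMem_support_iff.mp heV, sub_zero,
      sub_zero]
    exact mem_support_iff.mp he
  · by_cases he'S : e' ∈ (∏ i, u i - ∏ i, v i).support
    · exact hmin e' he'S hne
    · have hmem : e' ∈ ((∏ i, u i - ∏ i, U i) - (∏ i, v i - ∏ i, V i)).support := by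
        rw [mem_support_iff] at he' ⊢
        rw [hcoeff, notMem_support_iff.mp he'S, zero_sub, neg_ne_zero] at he'
        rwa [coeff_sub]
      rcases Finset.mem_union.mp (support_sub (Fin 2) _ _ hmem) with h | h
      · exact (keyU e' h).1 hne
      · exact (keyV e' h).1 hne

/-- STUB 7a — LOCALISATION TO THE DEAD LETTERS.  Let `D = ∏ u − ∏ v` (constant terms `1`), `w` a strictly
positive integer weight and `e` the unique `w`-minimiser of `supp D`.  Then EITHER `e` is a letter of some
factor (a monomial of some `u_i` or `v_i`), OR `e` is still the unique `w`-minimiser of `supp D‡`, where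
`D‡ = ∏ u‡ − ∏ v‡` and `u‡_i` is `u_i` with every monomial lying in `supp D` deleted. [folklore] -/
theorem stub_localisation : ∀ (n : ℕ) (u v : Fin n → MvPolynomial (Fin 2) ℂ),
    (∀ i, MvPolynomial.coeff 0 (u i) = 1) → (∀ i, MvPolynomial.coeff 0 (v i) = 1) →
    ∀ (w : Fin 2 → ℤ), 0 < w 0 → 0 < w 1 → ∀ (e : Fin 2 →₀ ℕ),
    (e ∈ (∏ i, u i - ∏ i, v i).support ∧ ∀ e' ∈ (∏ i, u i - ∏ i, v i).support, e' ≠ e →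
      w 0 * (e 0 : ℤ) + w 1 * (e 1 : ℤ) < w 0 * (e' 0 : ℤ) + w 1 * (e' 1 : ℤ)) →
    (∃ i, e ∈ (u i).support ∨ e ∈ (v i).support) ∨
    (e ∈ (∏ i, (∑ a ∈ (u i).support with a ∉ (∏ j, u j - ∏ j, v j).support,
              MvPolynomial.monomial a (MvPolynomial.coeff a (u i))) -
          ∏ i, (∑ a ∈ (v i).support with a ∉ (∏ j, u j - ∏ j, v j).support,
              MvPolynomial.monomial a (MvPolynomial.coeff a (v i)))).support ∧
      ∀ e' ∈ (∏ i, (∑ a ∈ (u i).support with a ∉ (∏ j, u j - ∏ j, v j).support,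
              MvPolynomial.monomial a (MvPolynomial.coeff a (u i))) -
          ∏ i, (∑ a ∈ (v i).support with a ∉ (∏ j, u j - ∏ j, v j).support,
              MvPolynomial.monomial a (MvPolynomial.coeff a (v i)))).support, e' ≠ e →
        w 0 * (e 0 : ℤ) + w 1 * (e 1 : ℤ) < w 0 * (e' 0 : ℤ) + w 1 * (e' 1 : ℤ)) := by
  intro n u v _ _ w hw0 hw1 e he
  -- the weight `x ↦ w₀ x₀ + w₁ x₁` is nonnegative on `ℕ²` and positive off `0` (as in `…TwoProductsDepthOne`)
  have hnn : ∀ x : Fin 2 →₀ ℕ, 0 ≤ w 0 * (x 0 : ℤ) + w 1 * (x 1 : ℤ) := fun x =>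
    add_nonneg (mul_nonneg hw0.le (Nat.cast_nonneg _)) (mul_nonneg hw1.le (Nat.cast_nonneg _))
  have hpos : ∀ x : Fin 2 →₀ ℕ, x ≠ 0 → 0 < w 0 * (x 0 : ℤ) + w 1 * (x 1 : ℤ) := by
    intro x hx
    have h : x 0 ≠ 0 ∨ x 1 ≠ 0 := by
      by_contra h
      push Not at h
      exact hx (Finsupp.ext fun i => by fin_cases i <;> simp [h.1, h.2])
    rcases h with h | h
    · have h0 : (0 : ℤ) < x 0 := by exact_mod_cast Nat.pos_of_ne_zero h
      exact add_pos_of_pos_of_nonneg (mul_pos hw0 h0) (mul_nonneg hw1.le (Nat.cast_nonneg _))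
    · have h1 : (0 : ℤ) < x 1 := by exact_mod_cast Nat.pos_of_ne_zero h
      exact add_pos_of_nonneg_of_pos (mul_nonneg hw0.le (Nat.cast_nonneg _)) (mul_pos hw1 h1)
  exact localisation_of_support_sub u v
    (fun i => ∑ a ∈ (u i).support with a ∉ (∏ j, u j - ∏ j, v j).support, monomial a (coeff a (u i)))
    (fun i => ∑ a ∈ (v i).support with a ∉ (∏ j, u j - ∏ j, v j).support, monomial a (coeff a (v i)))
    (fun x => w 0 * (x 0 : ℤ) + w 1 * (x 1 : ℤ)) (wt_add w) hnn hpos e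
    (fun i b hb => mem_of_mem_support_sub_trunc _ (u i) b hb)
    (fun i b hb => mem_of_mem_support_sub_trunc _ (v i) b hb) he.1 he.2

end Summit.ValiantsHypothesis.ValiantsHypothesis.Theorems.TwoProducts.Localisation
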